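import Mathlib
import HarnessLib
import Summits.HubbardSuperconductivity.HubbardSuperconductivity.Theorems.KLProgrammeKLRegimeEnginePairLadderMultistep

/-!
# Route `KLProgramme` — crux K3, ENGINE child gen 5 (stmt-HubbardSuperconductivity-19918 `KLRegimeEngineV14`), stub `stub_engine_step_values`,
# conjunct (E2-v9) at `1 ≤ n`: lemmas for the weighted Duhamel comparison of the within-slice pair-vertex flow

Cell gate-hubbard-kl, seat hubbard-kl-k3c1-p1 (g5), technique «composed-map remainder propagation».  Three ingredients of
`kltc_riccati_duhamel_weighted` (`…EnginePairLadderDuhamel`): `kltc_resum_second_order_le` — one resummation step is second-order accurate,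
`‖(Γ·N − Γ + Γ·diag w·Γ)(x,y)‖ ≤ (3/2)m³(Σ|w|)²`; `kltc_rung_increment_le` — `‖b(u) − b(s)‖_a ≤ β(u − s)` (FTC); `kltc_flow_taylor_le` — the
Taylor step of `Γ̇ = −Γ·diag ḃ·Γ + X`: `‖Γ(u) − Γ(s) + Γ(s)·diag(b(u)−b(s))·Γ(s)‖(x,y) ≤ ∫_s^u‖X(t)(x,y)‖dt + ω(u − s)` when the frozen-vertex
bubble term oscillates by at most `ω` on `[s,u]`.  Real analysis + the landed algebra; nothing about the model is asserted.  0 kit.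
-/

noncomputable section

namespace Summit.HubbardSuperconductivity.HubbardSuperconductivity.Theorems.KLRegimeSplit

set_option linter.dupNamespace false -- summit = problem name (single-conjunct summit), D-0017

open Finset Matrix Set Literature.MathematicalPhysics.QuantumLattice Literature.Probability.LatticeModels
open Summit.HubbardSuperconductivity.HubbardSuperconductivity.Theorems.KLProgrammeCooperResummation

section Generic

variable {ι : Type*} [Fintype ι] [DecidableEq ι] [Nonempty ι]

/-- **Second-order accuracy of one resummation step.**  `(1 + diag w·Γ)·N = 1`, `|Γ| ≤ m`, `m·Σ|w| ≤ 1/3` ⟹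
`‖(Γ·N − Γ + Γ·diag w·Γ)(x,y)‖ ≤ (3/2)·m³·(Σ|w|)²` (exactly: `Γ·N − Γ + Γ·diag w·Γ = Γ·diag w·Γ·diag w·(Γ·N)`). -/
theorem kltc_resum_second_order_le (Γ N : Matrix ι ι ℂ) (w : ι → ℂ) {m : ℝ} (hm : 0 ≤ m) (hΓ : ∀ x y, ‖Γ x y‖ ≤ m)
    (hw : m * ∑ a, ‖w a‖ ≤ 1 / 3) (hN : (1 + diagonal w * Γ) * N = 1) (x y : ι) :
    ‖(Γ * N) x y - Γ x y + (Γ * diagonal w * Γ) x y‖ ≤ 3 / 2 * m ^ 3 * (∑ a, ‖w a‖) ^ 2 := by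
  obtain ⟨N₁, _, hN₁1, hN₁2, -, -, -, -, -, hΓN, -, -⟩ := klcrs_single_slice w hm Γ hΓ hw
  have hNN : N = N₁ := by
    calc N = N₁ * (1 + diagonal w * Γ) * N := by rw [hN₁2, one_mul]
      _ = N₁ := by rw [mul_assoc, hN, mul_one]
  subst hNN
  set D : Matrix ι ι ℂ := diagonal w with hD_def
  have hid : Γ * N - Γ + Γ * D * Γ = Γ * D * (Γ * D * (Γ * N)) := by
    have h1 : N = 1 - D * Γ * N := by
      calc N = (1 + D * Γ) * N - D * Γ * N := by noncomm_ring
        _ = 1 - D * Γ * N := by rw [hN]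
    calc Γ * N - Γ + Γ * D * Γ = Γ * (1 - D * Γ * N) - Γ + Γ * D * Γ := by rw [← h1]
      _ = Γ * D * (Γ - Γ * N) := by noncomm_ring
      _ = Γ * D * (Γ - Γ * (1 - D * Γ * N)) := by rw [← h1]
      _ = Γ * D * (Γ * D * (Γ * N)) := by noncomm_ring
  have hent : (Γ * N) x y - Γ x y + (Γ * D * Γ) x y = (Γ * D * (Γ * D * (Γ * N))) x y := by
    have h := congrArg (fun M : Matrix ι ι ℂ => M x y) hid
    simpa only [Matrix.add_apply, Matrix.sub_apply] using h
  rw [hent]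
  set σ : ℝ := ∑ a, ‖w a‖ with hσ_def
  have hσ0 : 0 ≤ σ := sum_nonneg fun a _ => norm_nonneg _
  have hinner : ∀ a, ‖(Γ * D * (Γ * N)) a y‖ ≤ m * σ * (3 / 2 * m) := by
    intro a
    refine (klell_norm_mul_diag_mul_apply_le Γ (Γ * N) w a y).trans ?_
    calc ∑ c, ‖Γ a c‖ * ‖w c‖ * ‖(Γ * N) c y‖ ≤ ∑ c, m * ‖w c‖ * (3 / 2 * m) :=
          sum_le_sum fun c _ => mul_le_mul (mul_le_mul_of_nonneg_right (hΓ a c) (norm_nonneg _)) (hΓN c y) (norm_nonneg _)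
            (mul_nonneg hm (norm_nonneg _))
      _ = m * σ * (3 / 2 * m) := by rw [← Finset.sum_mul, ← Finset.mul_sum, ← hσ_def]
  refine (klell_norm_mul_diag_mul_apply_le Γ (Γ * D * (Γ * N)) w x y).trans ?_
  calc ∑ a, ‖Γ x a‖ * ‖w a‖ * ‖(Γ * D * (Γ * N)) a y‖ ≤ ∑ a, m * ‖w a‖ * (m * σ * (3 / 2 * m)) :=
        sum_le_sum fun a _ => mul_le_mul (mul_le_mul_of_nonneg_right (hΓ x a) (norm_nonneg _)) (hinner a) (norm_nonneg _)
          (mul_nonneg hm (norm_nonneg _))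
    _ = 3 / 2 * m ^ 3 * σ ^ 2 := by
        rw [← Finset.sum_mul, ← Finset.mul_sum, ← hσ_def]; ring


omit [DecidableEq ι] [Nonempty ι] in
/-- **Rung increment over a subinterval**: `‖b(u)_a − b(s)_a‖ ≤ β·(u − s)` from the rate bound `Σ_a‖ḃ(t)_a‖ ≤ β` (FTC). -/
theorem kltc_rung_increment_le (b b' : ℝ → ι → ℂ) {β : ℝ}
    (hb : ∀ t ∈ Icc (0 : ℝ) 1, ∀ a, HasDerivAt (fun s => b s a) (b' t a) t) (hb'c : ∀ a, ContinuousOn (fun t => b' t a) (Icc 0 1))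
    (hβ : ∀ t ∈ Icc (0 : ℝ) 1, ∑ a, ‖b' t a‖ ≤ β) {s u : ℝ} (hs : s ∈ Icc (0 : ℝ) 1) (hu : u ∈ Icc (0 : ℝ) 1) (hsu : s ≤ u) (a : ι) :
    (∫ t in s..u, b' t a) = b u a - b s a ∧ ‖b u a - b s a‖ ≤ β * (u - s) := by
  have hsub : uIcc s u ⊆ Icc (0 : ℝ) 1 := by rw [uIcc_of_le hsu]; exact Icc_subset_Icc hs.1 hu.2
  have hFTC : (∫ t in s..u, b' t a) = b u a - b s a :=
    intervalIntegral.integral_eq_sub_of_hasDerivAt (fun t ht => hb t (hsub ht) a) ((hb'c a).mono hsub).intervalIntegrable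
  refine ⟨hFTC, ?_⟩
  rw [← hFTC]
  have h := intervalIntegral.norm_integral_le_of_norm_le_const (a := s) (b := u) (f := fun t => b' t a) (C := β) ?_
  · rwa [abs_of_nonneg (sub_nonneg.2 hsu)] at h
  · intro t ht
    rw [uIoc_of_le hsu] at ht
    have ht' : t ∈ Icc (0 : ℝ) 1 := ⟨hs.1.trans ht.1.le, ht.2.trans hu.2⟩
    exact (single_le_sum (f := fun a => ‖b' t a‖) (fun a _ => norm_nonneg _) (mem_univ a)).trans (hβ t ht')

omit [Nonempty ι] in
/-- **Taylor step of the flow.**  With `Γ̇ = −Γ·diag ḃ·Γ + X` on `[0,1]` and `s ≤ u` in `[0,1]`: if the frozen-vertex bubble term oscillates by at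
most `ω` on `[s,u]` (`‖(Γ(s)·diag ḃ(t)·Γ(s) − Γ(t)·diag ḃ(t)·Γ(t))(x,y)‖ ≤ ω`), then
`‖Γ(u) − Γ(s) + Γ(s)·diag(b(u) − b(s))·Γ(s)‖(x,y) ≤ ∫_s^u ‖X(t)(x,y)‖dt + ω·(u − s)`. -/
theorem kltc_flow_taylor_le (Γ Γ' X : ℝ → Matrix ι ι ℂ) (b b' : ℝ → ι → ℂ)
    (hΓ : ∀ t ∈ Icc (0 : ℝ) 1, ∀ x y, HasDerivAt (fun s => Γ s x y) (Γ' t x y) t)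
    (hb : ∀ t ∈ Icc (0 : ℝ) 1, ∀ a, HasDerivAt (fun s => b s a) (b' t a) t)
    (hΓ'c : ∀ x y, ContinuousOn (fun t => Γ' t x y) (Icc 0 1)) (hb'c : ∀ a, ContinuousOn (fun t => b' t a) (Icc 0 1))
    (hX : ∀ t ∈ Icc (0 : ℝ) 1, X t = Γ' t + Γ t * diagonal (b' t) * Γ t)
    {s u : ℝ} (hs : s ∈ Icc (0 : ℝ) 1) (hu : u ∈ Icc (0 : ℝ) 1) (hsu : s ≤ u) (x y : ι) {ω : ℝ}
    (hω : ∀ t ∈ Icc s u, ‖(Γ s * diagonal (b' t) * Γ s) x y - (Γ t * diagonal (b' t) * Γ t) x y‖ ≤ ω) :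
    ‖Γ u x y - Γ s x y + (Γ s * diagonal (b u - b s) * Γ s) x y‖ ≤ (∫ t in s..u, ‖X t x y‖) + ω * (u - s) := by
  have hsub : uIcc s u ⊆ Icc (0 : ℝ) 1 := by rw [uIcc_of_le hsu]; exact Icc_subset_Icc hs.1 hu.2
  have hsub' : Icc s u ⊆ Icc (0 : ℝ) 1 := Icc_subset_Icc hs.1 hu.2
  -- continuity of the data
  have hΓc : ∀ x y, ContinuousOn (fun t => Γ t x y) (Icc 0 1) := fun x y t ht => (hΓ t ht x y).continuousAt.continuousWithinAt
  have hGt : ∀ z : ℝ, ContinuousOn (fun t => (Γ z * diagonal (b' t) * Γ z) x y) (Icc 0 1) := by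
    intro z
    have h : ∀ t, (Γ z * diagonal (b' t) * Γ z) x y = ∑ a, Γ z x a * b' t a * Γ z a y := fun t => klli_mul_diag_mul_apply _ _ _ _ _
    simp_rw [h]
    exact continuousOn_finsetSum _ fun a _ => (continuousOn_const.mul (hb'c a)).mul continuousOn_const
  have hGd : ContinuousOn (fun t => (Γ t * diagonal (b' t) * Γ t) x y) (Icc 0 1) := by
    have h : ∀ t, (Γ t * diagonal (b' t) * Γ t) x y = ∑ a, Γ t x a * b' t a * Γ t a y := fun t => klli_mul_diag_mul_apply _ _ _ _ _
    simp_rw [h]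
    exact continuousOn_finsetSum _ fun a _ => ((hΓc x a).mul (hb'c a)).mul (hΓc a y)
  have hXc : ContinuousOn (fun t => X t x y) (Icc 0 1) := by
    have h : ∀ t ∈ Icc (0 : ℝ) 1, X t x y = Γ' t x y + (Γ t * diagonal (b' t) * Γ t) x y := fun t ht => by
      rw [hX t ht, Matrix.add_apply]
    exact ((hΓ'c x y).add hGd).congr h
  have hXint : IntervalIntegrable (fun t => X t x y) MeasureTheory.volume s u := (hXc.mono hsub).intervalIntegrable
  have hGdint : IntervalIntegrable (fun t => (Γ t * diagonal (b' t) * Γ t) x y) MeasureTheory.volume s u :=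
    (hGd.mono hsub).intervalIntegrable
  have hGsint : IntervalIntegrable (fun t => (Γ s * diagonal (b' t) * Γ s) x y) MeasureTheory.volume s u :=
    ((hGt s).mono hsub).intervalIntegrable
  -- FTC for `Γ` and for `b`
  have hFTCΓ : (∫ t in s..u, Γ' t x y) = Γ u x y - Γ s x y :=
    intervalIntegral.integral_eq_sub_of_hasDerivAt (fun t ht => hΓ t (hsub ht) x y) ((hΓ'c x y).mono hsub).intervalIntegrable
  have hFTCb : ∀ a, (∫ t in s..u, b' t a) = b u a - b s a := fun a =>
    intervalIntegral.integral_eq_sub_of_hasDerivAt (fun t ht => hb t (hsub ht) a) ((hb'c a).mono hsub).intervalIntegrable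
  -- the identity
  have h1 : (∫ t in s..u, (X t x y - (Γ t * diagonal (b' t) * Γ t) x y)) = Γ u x y - Γ s x y := by
    rw [← hFTCΓ]
    refine intervalIntegral.integral_congr fun t ht => ?_
    have hXt := congrArg (fun M : Matrix ι ι ℂ => M x y) (hX t (hsub ht))
    simp only [Matrix.add_apply] at hXt
    rw [hXt]; ring
  have h2 : (∫ t in s..u, (Γ s * diagonal (b' t) * Γ s) x y) = (Γ s * diagonal (b u - b s) * Γ s) x y := by
    have h : ∀ t, (Γ s * diagonal (b' t) * Γ s) x y = ∑ a, Γ s x a * b' t a * Γ s a y := fun t => klli_mul_diag_mul_apply _ _ _ _ _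
    simp_rw [h]
    rw [intervalIntegral.integral_finsetSum (fun a _ => ?_), klli_mul_diag_mul_apply]
    · refine sum_congr rfl fun a _ => ?_
      rw [intervalIntegral.integral_mul_const, intervalIntegral.integral_const_mul, hFTCb a, Pi.sub_apply]
    · exact (((continuousOn_const.mul (hb'c a)).mul continuousOn_const).mono hsub).intervalIntegrable
  have hA_eq : Γ u x y - Γ s x y + (Γ s * diagonal (b u - b s) * Γ s) x y =
      ∫ t in s..u, (X t x y - (Γ t * diagonal (b' t) * Γ t) x y + (Γ s * diagonal (b' t) * Γ s) x y) := by
    rw [intervalIntegral.integral_add (hXint.sub hGdint) hGsint, h1, h2]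
  rw [hA_eq]
  have hg : IntervalIntegrable (fun t => ‖X t x y‖ + ω) MeasureTheory.volume s u := hXint.norm.add intervalIntegrable_const
  refine (intervalIntegral.norm_integral_le_of_norm_le hsu ?_ hg).trans (le_of_eq ?_)
  · refine Filter.Eventually.of_forall fun t ht => ?_
    have ht' : t ∈ Icc s u := ⟨ht.1.le, ht.2⟩
    calc ‖X t x y - (Γ t * diagonal (b' t) * Γ t) x y + (Γ s * diagonal (b' t) * Γ s) x y‖
        = ‖X t x y + ((Γ s * diagonal (b' t) * Γ s) x y - (Γ t * diagonal (b' t) * Γ t) x y)‖ := by ring_nf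
      _ ≤ ‖X t x y‖ + ‖(Γ s * diagonal (b' t) * Γ s) x y - (Γ t * diagonal (b' t) * Γ t) x y‖ := norm_add_le _ _
      _ ≤ ‖X t x y‖ + ω := by linarith [hω t ht']
  · rw [intervalIntegral.integral_add hXint.norm intervalIntegrable_const, intervalIntegral.integral_const, smul_eq_mul]
    ring

end Generic

end Summit.HubbardSuperconductivity.HubbardSuperconductivity.Theorems.KLRegimeSplit

end
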